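import Literature.Topology.FourManifolds.StableFramesAlongDiscs
import Literature.Topology.FourManifolds.StableRangeFramePeel
import Mathlib.Geometry.Manifold.Instances.Sphere
import HarnessLib

/-!
# Maps of spheres into `GL` in the stable range: `Sᵏ → GL_{m+j}(ℝ)` deforms into `1_j ⊕ GL_m(ℝ)`
# for `k < m`

Topic `Literature/Topology/FourManifolds` (infrastructure for the fact seat of
`Literature.Topology.FourManifolds.HomotopySphere.exists_highlyConnected_of_mem_signatureSet`,
brick B5α: the framing correction `α : Sᵏ → GL_m` of Kosinski X.(2.1) / Kervaire–Milnor's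
Lemma 5.4 and 6.2, "the framing of the imbedded sphere can be chosen so that the given framing
extends").  The homotopy-theoretic input is the **stability of `π_k(GL_M(ℝ))`**: the inclusion
`GL_M → GL_{M+1}`, `A ↦ 1 ⊕ A`, is onto on free homotopy classes of maps from `Sᵏ` as soon as
`k < M` (Steenrod, *The Topology of Fibre Bundles* (1951), §38; Hatcher, *Algebraic Topology*,
§4.2, Example 4.55: the bundle `GL_M → GL_{M+1} → ℝ^{M+1} ∖ 0 ≃ Sᴹ` and `π_k(Sᴹ) = 0` for
`k < M`; Kosinski, *Differential Manifolds* (1993), Appendix §5 p. 230).  It is proved here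
directly and elementarily for maps into the invertible matrices `NzMat` of
`StableFramesAlongDiscs.lean`, iterated:

* `NzMat.homotopic_one_rotMat` — a continuous family of transport rotations `R(a(x), b(x))`
  (`a`, `b` unit, nowhere antipodal; `…Stability.lean`) is homotopic to the constant `1`;
* `NzMat.exists_homotopic_stab` — **one peeling step**: every continuous `γ : Sᵏ → GL_{M+1}(ℝ)`
  with `k < M` is homotopic to `u ↦ 1 ⊕ B(u)` for a continuous `B : Sᵏ → GL_M(ℝ)`.  Proof: the
  first column `v = γ e₀`, normalised, is a map `Sᵏ → Sᴹ`; by the tree's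
  `exists_sphereMap_near_missing_antipode` (smooth approximation and Hausdorff dimension) it is
  nowhere antipodal to a continuous unit `b` which misses an antipode `-p`; the transport
  rotations `v̂ ↦ b ↦ p ↦ q₀ ↦ e₀` and the scalar `1/‖v‖`, all homotopic to `1`, turn `γ` into a
  map with first column `e₀`, i.e. `[[1, r], [0, B]]`, and the shear `r` is removed linearly;
* `NzMat.exists_homotopic_stabPow` — **iteration**: for `k < m` every continuous
  `γ : Sᵏ → GL_{m+j}(ℝ)` is homotopic to `u ↦ 1_j ⊕ α(u)` with `α : Sᵏ → GL_m(ℝ)` continuous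
  (the `j` peeling steps need `k < m + j - 1, …, k < m`);
* `NzMat.exists_contMDiff_homotopic` — a continuous `α : Sᵏ → GL_m(ℝ)` is homotopic to one with
  `C^∞` entries (smooth approximation inside the open set `det ≠ 0`).

Everything is proved; no definitions besides the explicit matrices `NzMat.shearBlock`,
`NzMat.stabPow`, no named facts.

## References

* N. Steenrod, *The Topology of Fibre Bundles*, Princeton 1951, §38 (homotopy groups of the
  classical groups in the stable range). [Steenrod1951]
* A. Hatcher, *Algebraic Topology*, CUP 2002, §4.2, Example 4.55. [HatcherAT2002]
* A. Kosinski, *Differential Manifolds* (1993), X, Lemma (2.1); Appendix §5. [Kosinski1993]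
* M. Kervaire, J. Milnor, *Groups of homotopy spheres I*, Ann. of Math. 77 (1963), Lemma 5.4,
  Lemma 6.2. [KervaireMilnorAnnals1963]
-/

open scoped Manifold ContDiff Topology
open Set Function Metric Matrix Module

noncomputable section

namespace Literature.Topology.FourManifolds

namespace StableFrames.NzMat

open SOTransport

/-- Local notation: `𝕊 n` is the unit sphere in `EuclideanSpace ℝ (Fin (n + 1))`. -/
local notation "𝕊 " n:arg => (Metric.sphere (0 : EuclideanSpace ℝ (Fin (n + 1))) 1)

attribute [local instance] fact_finrank_euclideanSpace_succ

variable {X : Type*} [TopologicalSpace X]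

/-! ### Homotopies of maps into `NzMat` -/

/-- Products of homotopic maps into the invertible matrices are homotopic. [folklore] -/
theorem homotopic_mul {M : ℕ} {f f' g g' : C(X, NzMat M)} (hf : f.Homotopic f')
    (hg : g.Homotopic g') : (f * g).Homotopic (f' * g') := by
  obtain ⟨F⟩ := hf
  obtain ⟨G⟩ := hg
  exact ⟨{ toFun := fun p => F p * G p
           continuous_toFun := F.continuous.mul G.continuous
           map_zero_left := fun x => by simp
           map_one_left := fun x => by simp }⟩

/-- A map into `NzMat` built from a jointly continuous family of matrices over `I × X` with
non-vanishing determinant is a homotopy between its ends. [folklore] -/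
theorem homotopic_of_family {M : ℕ} (H : unitInterval × X → Matrix (Fin M) (Fin M) ℝ)
    (hH : Continuous H) (hdet : ∀ p, (H p).det ≠ 0) (f g : C(X, NzMat M))
    (h0 : ∀ x, H (0, x) = (f x).1) (h1 : ∀ x, H (1, x) = (g x).1) : f.Homotopic g :=
  ⟨{ toFun := fun p => ⟨H p, hdet p⟩
     continuous_toFun := hH.subtype_mk _
     map_zero_left := fun x => Subtype.ext (h0 x)
     map_one_left := fun x => Subtype.ext (h1 x) }⟩

/-- A continuous family of positive scalar matrices is homotopic to the constant `1`.
[folklore] -/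
theorem homotopic_one_smul {M : ℕ} {c : X → ℝ} (hc : Continuous c) (hpos : ∀ x, 0 < c x)
    (hdet : ∀ x, (c x • (1 : Matrix (Fin M) (Fin M) ℝ)).det ≠ 0)
    (hcont : Continuous fun x => (⟨c x • (1 : Matrix (Fin M) (Fin M) ℝ), hdet x⟩ : NzMat M)) :
    (ContinuousMap.const X (1 : NzMat M)).Homotopic ⟨_, hcont⟩ := by
  refine homotopic_of_family (fun p => ((1 - (p.1 : ℝ)) + (p.1 : ℝ) * c p.2) •
    (1 : Matrix (Fin M) (Fin M) ℝ)) ?_ ?_ _ _ (fun x => by simp) (fun x => by simp)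
  · exact (((continuous_const.sub (continuous_subtype_val.comp continuous_fst))).add
      ((continuous_subtype_val.comp continuous_fst).mul (hc.comp continuous_snd))).smul
      continuous_const
  · rintro ⟨t, x⟩
    have ht0 : 0 ≤ (t : ℝ) := t.2.1
    have ht1 : (t : ℝ) ≤ 1 := t.2.2
    have hpos' : 0 < (1 - (t : ℝ)) + (t : ℝ) * c x := by
      rcases eq_or_lt_of_le ht1 with h | h
      · rw [h]; simpa using hpos x
      · exact add_pos_of_pos_of_nonneg (by linarith) (mul_nonneg ht0 (hpos x).le)
    rw [det_smul, det_one, mul_one]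
    exact pow_ne_zero _ hpos'.ne'

/-- Determinant of a positive scalar matrix is non-zero. [folklore] -/
theorem det_smul_one_ne_zero {M : ℕ} {c : ℝ} (hc : 0 < c) :
    (c • (1 : Matrix (Fin M) (Fin M) ℝ)).det ≠ 0 := by
  rw [det_smul, det_one, mul_one]; exact pow_ne_zero _ hc.ne'

/-! ### Transport rotations are homotopic to `1` -/

section Rot

variable {M : ℕ}

/-- Coordinates of a unit vector have `a ⬝ᵥ a = 1`. [folklore] -/
theorem dotProduct_self_of_norm_eq_one {a : EuclideanSpace ℝ (Fin M)} (ha : ‖a‖ = 1) :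
    WithLp.ofLp a ⬝ᵥ WithLp.ofLp a = 1 := by
  rw [← norm_sq_eq_dotProduct, ha, one_pow]

/-- For `a + b ≠ 0`, `(a + b) ⬝ᵥ (a + b) ≠ 0` in coordinates. [folklore] -/
theorem dotProduct_add_self_ne_zero' {a b : EuclideanSpace ℝ (Fin M)} (h : a + b ≠ 0) :
    (WithLp.ofLp a + WithLp.ofLp b) ⬝ᵥ (WithLp.ofLp a + WithLp.ofLp b) ≠ 0 := by
  rw [← WithLp.ofLp_add, ← norm_sq_eq_dotProduct]
  exact pow_ne_zero _ (norm_ne_zero_iff.2 h)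

/-- The normalised segment between two nowhere antipodal unit vector fields is a unit vector
field, never antipodal to the first one. [folklore] -/
theorem segment_normalise {a b : EuclideanSpace ℝ (Fin M)} (ha : ‖a‖ = 1) (hb : ‖b‖ = 1)
    (hab : a + b ≠ 0) {t : ℝ} (ht0 : 0 ≤ t) (ht1 : t ≤ 1) :
    (1 - t) • a + t • b ≠ 0 ∧
      a + ‖(1 - t) • a + t • b‖⁻¹ • ((1 - t) • a + t • b) ≠ 0 := by
  have hne : (1 - t) • a + t • b ≠ 0 := convexComb_ne_zero ha hb hab ht0 ht1
  refine ⟨hne, fun h0 => ?_⟩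
  -- `a = -n` with `n` the normalised combination: then `(1 - t) a + t b = -‖…‖ a`, so `b ∥ a`
  set c := ‖(1 - t) • a + t • b‖ with hc
  have hcpos : 0 < c := norm_pos_iff.2 hne
  have h1 : (1 - t) • a + t • b = -(c • a) := by
    have : c • (a + c⁻¹ • ((1 - t) • a + t • b)) = 0 := by rw [h0, smul_zero]
    rw [smul_add, smul_smul, mul_inv_cancel₀ hcpos.ne', one_smul] at this
    exact (neg_eq_of_add_eq_zero_right this).symm
  -- so `t • b = -(c + 1 - t) • a`; taking norms, `t = c + 1 - t`, and then `b = -a`.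
  have h2 : t • b = -((c + 1 - t) • a) := by
    have := h1
    rw [add_comm] at this
    have h3 : t • b = -(c • a) - (1 - t) • a := eq_sub_of_add_eq this
    rw [h3]; module
  rcases eq_or_lt_of_le ht0 with rfl | htpos
  · simp only [zero_smul, sub_zero, zero_eq_neg, smul_eq_zero] at h2
    rcases h2 with h2 | h2
    · linarith
    · rw [h2, norm_zero] at ha; exact zero_ne_one ha
  · have hn := congrArg (‖·‖) h2
    simp only [norm_smul, norm_neg, hb, ha, mul_one, Real.norm_eq_abs, abs_of_pos htpos] at hn
    have hct : c + 1 - t = t := by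
      rw [abs_eq_self.2 (by linarith)] at hn; linarith
    rw [hct] at h2
    have hb' : b = -a := by
      have := congrArg (fun v => t⁻¹ • v) h2
      simp only [smul_neg, smul_smul, inv_mul_cancel₀ htpos.ne', one_smul] at this
      exact this
    exact hab (by rw [hb', add_neg_cancel])

/-- **A continuous family of transport rotations is homotopic to the identity**: for continuous
unit vector fields `a`, `b` on `X` with `a + b ≠ 0` everywhere, `x ↦ R(a x, b x)` is homotopic,
through invertible matrices, to the constant `1` — along `t ↦ R(a, n_t)` with `n_t` the normalised
segment from `a` to `b`. [folklore] -/
theorem homotopic_one_rotMat {a b : X → EuclideanSpace ℝ (Fin M)} (hac : Continuous a)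
    (hbc : Continuous b) (ha : ∀ x, ‖a x‖ = 1) (hb : ∀ x, ‖b x‖ = 1) (hab : ∀ x, a x + b x ≠ 0)
    (hdet : ∀ x, (rotMat (WithLp.ofLp (a x)) (WithLp.ofLp (b x))).det ≠ 0)
    (hcont : Continuous fun x => (⟨rotMat (WithLp.ofLp (a x)) (WithLp.ofLp (b x)), hdet x⟩ :
      NzMat M)) :
    (ContinuousMap.const X (1 : NzMat M)).Homotopic ⟨_, hcont⟩ := by
  -- the normalised segment
  set n : unitInterval × X → EuclideanSpace ℝ (Fin M) := fun p =>
    ‖(1 - (p.1 : ℝ)) • a p.2 + (p.1 : ℝ) • b p.2‖⁻¹ • ((1 - (p.1 : ℝ)) • a p.2 + (p.1 : ℝ) • b p.2)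
    with hn
  have hseg : ∀ p : unitInterval × X, (1 - (p.1 : ℝ)) • a p.2 + (p.1 : ℝ) • b p.2 ≠ 0 ∧
      a p.2 + n p ≠ 0 := fun p =>
    segment_normalise (ha p.2) (hb p.2) (hab p.2) p.1.2.1 p.1.2.2
  have hn1 : ∀ p, ‖n p‖ = 1 := fun p => norm_smul_inv_norm (hseg p).1
  have hsegc : Continuous fun p : unitInterval × X =>
      (1 - (p.1 : ℝ)) • a p.2 + (p.1 : ℝ) • b p.2 :=
    ((continuous_const.sub (continuous_subtype_val.comp continuous_fst)).smul
      (hac.comp continuous_snd)).add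
      ((continuous_subtype_val.comp continuous_fst).smul (hbc.comp continuous_snd))
  have hnc : Continuous n :=
    (hsegc.norm.inv₀ fun p => norm_ne_zero_iff.2 (hseg p).1).smul hsegc
  refine homotopic_of_family
    (fun p => rotMat (WithLp.ofLp (a p.2)) (WithLp.ofLp (n p))) ?_ ?_ _ _ ?_ ?_
  · refine continuous_rotMat (f := fun p : unitInterval × X => WithLp.ofLp (a p.2))
      (g := fun p => WithLp.ofLp (n p))
      ((PiLp.continuous_ofLp 2 _).comp (hac.comp continuous_snd))
      ((PiLp.continuous_ofLp 2 _).comp hnc) (fun p => ?_) (fun p => ?_)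
    · rw [dotProduct_self_of_norm_eq_one (hn1 p)]; exact one_ne_zero
    · exact dotProduct_add_self_ne_zero' (hseg p).2
  · intro p
    rw [det_rotMat]
    · exact one_ne_zero
    · rw [dotProduct_self_of_norm_eq_one (hn1 p)]; exact one_ne_zero
    · exact dotProduct_add_self_ne_zero' (hseg p).2
  · intro x
    have h0 : n (0, x) = a x := by
      simp [hn, ha x]
    rw [h0, ContinuousMap.const_apply, one_val]
    exact rotMat_self (by rw [dotProduct_self_of_norm_eq_one (ha x)]; exact one_ne_zero)
  · intro x
    have h1 : n (1, x) = b x := by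
      simp [hn, hb x]
    rw [h1]
    rfl

/-- The transport rotation of two nowhere antipodal continuous unit vector fields, as a
continuous map into `NzMat`. [folklore] -/
theorem continuous_rotMat_mk {a b : X → EuclideanSpace ℝ (Fin M)} (hac : Continuous a)
    (hbc : Continuous b) (hb : ∀ x, ‖b x‖ = 1) (hab : ∀ x, a x + b x ≠ 0)
    (hdet : ∀ x, (rotMat (WithLp.ofLp (a x)) (WithLp.ofLp (b x))).det ≠ 0) :
    Continuous fun x => (⟨rotMat (WithLp.ofLp (a x)) (WithLp.ofLp (b x)), hdet x⟩ : NzMat M) :=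
  (continuous_rotMat (f := fun x => WithLp.ofLp (a x)) (g := fun x => WithLp.ofLp (b x))
    ((PiLp.continuous_ofLp 2 _).comp hac) ((PiLp.continuous_ofLp 2 _).comp hbc)
    (fun x => by rw [dotProduct_self_of_norm_eq_one (hb x)]; exact one_ne_zero)
    (fun x => dotProduct_add_self_ne_zero' (hab x))).subtype_mk _

/-- Determinant of a transport rotation of unit vectors `a`, `b`, `a + b ≠ 0`, is non-zero.
[folklore] -/
theorem det_rotMat_ne_zero {a b : EuclideanSpace ℝ (Fin M)} (hb : ‖b‖ = 1) (hab : a + b ≠ 0) :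
    (rotMat (WithLp.ofLp a) (WithLp.ofLp b)).det ≠ 0 := by
  rw [det_rotMat (by rw [dotProduct_self_of_norm_eq_one hb]; exact one_ne_zero)
    (dotProduct_add_self_ne_zero' hab)]
  exact one_ne_zero

/-- A transport rotation of unit vectors takes `a` to `b` (Euclidean form). [folklore] -/
theorem rotMat_mulVec_unit {a b : EuclideanSpace ℝ (Fin M)} (ha : ‖a‖ = 1) (hb : ‖b‖ = 1)
    (hab : a + b ≠ 0) :
    rotMat (WithLp.ofLp a) (WithLp.ofLp b) *ᵥ WithLp.ofLp a = WithLp.ofLp b :=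
  rotMat_mulVec_left (by rw [dotProduct_self_of_norm_eq_one ha, dotProduct_self_of_norm_eq_one hb])
    (by rw [dotProduct_self_of_norm_eq_one hb]; exact one_ne_zero) (dotProduct_add_self_ne_zero' hab)

end Rot

/-! ### Block matrices `[[1, t r], [0, B]]` -/

section Shear

variable {M : ℕ}

/-- The block matrix `[[1, t r], [0, B]]` (first row `(1, t r)`, first column `e₀`, lower-right
block `B`). [folklore] -/
def shearBlock (t : ℝ) (r : Fin M → ℝ) (B : Matrix (Fin M) (Fin M) ℝ) :
    Matrix (Fin (M + 1)) (Fin (M + 1)) ℝ :=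
  Matrix.of (Fin.cons (Fin.cons 1 (t • r) : Fin (M + 1) → ℝ) fun i => Fin.cons 0 (B i))

/-- Entry `(0,0)` of `[[1, t r], [0, B]]`. [folklore] -/
@[simp] theorem shearBlock_zero_zero (t : ℝ) (r : Fin M → ℝ) (B : Matrix (Fin M) (Fin M) ℝ) :
    shearBlock t r B 0 0 = 1 := by simp [shearBlock]

/-- First row of `[[1, t r], [0, B]]` off the diagonal. [folklore] -/
@[simp] theorem shearBlock_zero_succ (t : ℝ) (r : Fin M → ℝ) (B : Matrix (Fin M) (Fin M) ℝ)
    (j : Fin M) : shearBlock t r B 0 j.succ = t * r j := by simp [shearBlock]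

/-- First column of `[[1, t r], [0, B]]` off the diagonal. [folklore] -/
@[simp] theorem shearBlock_succ_zero (t : ℝ) (r : Fin M → ℝ) (B : Matrix (Fin M) (Fin M) ℝ)
    (i : Fin M) : shearBlock t r B i.succ 0 = 0 := by simp [shearBlock]

/-- Lower-right block of `[[1, t r], [0, B]]`. [folklore] -/
@[simp] theorem shearBlock_succ_succ (t : ℝ) (r : Fin M → ℝ) (B : Matrix (Fin M) (Fin M) ℝ)
    (i j : Fin M) : shearBlock t r B i.succ j.succ = B i j := by simp [shearBlock]

/-- `[[1, 0], [0, B]] = 1 ⊕ B`. [folklore] -/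
theorem shearBlock_zero (r : Fin M → ℝ) (B : Matrix (Fin M) (Fin M) ℝ) :
    shearBlock 0 r B = blockSucc B := by
  ext i j
  refine Fin.cases ?_ (fun i' => ?_) i <;> refine Fin.cases ?_ (fun j' => ?_) j <;> simp

/-- `det [[1, t r], [0, B]] = det B` (expansion along the first column). [folklore] -/
theorem det_shearBlock (t : ℝ) (r : Fin M → ℝ) (B : Matrix (Fin M) (Fin M) ℝ) :
    (shearBlock t r B).det = B.det := by
  rw [Matrix.det_succ_column_zero, Fin.sum_univ_succ]
  simp [Matrix.submatrix]
  rfl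

/-- `[[1, t r], [0, B]]` is jointly continuous in `(t, r, B)`. [folklore] -/
theorem continuous_shearBlock {Y : Type*} [TopologicalSpace Y] {t : Y → ℝ} {r : Y → Fin M → ℝ}
    {B : Y → Matrix (Fin M) (Fin M) ℝ} (ht : Continuous t) (hr : Continuous r)
    (hB : Continuous B) : Continuous fun y => shearBlock (t y) (r y) (B y) := by
  refine continuous_matrix fun i j => ?_
  refine Fin.cases ?_ (fun i' => ?_) i <;> refine Fin.cases ?_ (fun j' => ?_) j
  · simp only [shearBlock_zero_zero]; exact continuous_const
  · simp only [shearBlock_zero_succ]; exact ht.mul ((continuous_apply j').comp hr)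
  · simp only [shearBlock_succ_zero]; exact continuous_const
  · simp only [shearBlock_succ_succ]; exact ((continuous_apply j').comp ((continuous_apply i').comp hB))

/-- A matrix whose first column is `e₀` is `[[1, r], [0, B]]` with `r` its first row tail and `B`
its lower-right block. [folklore] -/
theorem eq_shearBlock_of_apply_zero {A : Matrix (Fin (M + 1)) (Fin (M + 1)) ℝ} (h0 : A 0 0 = 1)
    (h1 : ∀ i : Fin M, A i.succ 0 = 0) :
    A = shearBlock 1 (fun j => A 0 j.succ) (A.submatrix Fin.succ Fin.succ) := by
  ext i j
  refine Fin.cases ?_ (fun i' => ?_) i <;> refine Fin.cases ?_ (fun j' => ?_) j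
  · simp [h0]
  · simp
  · simp [h1]
  · simp

end Shear

/-! ### The peeling step -/

/-- The first column of an invertible matrix is non-zero. [folklore] -/
theorem col_zero_ne_zero {M : ℕ} (A : NzMat (M + 1)) : (fun i => A.1 i 0) ≠ 0 := by
  intro h
  apply A.2
  exact Matrix.det_eq_zero_of_column_eq_zero 0 fun i => congrFun h i

/-- The first column of a product is the matrix applied to the first column. [folklore] -/
theorem mul_apply_zero {M : ℕ} (A B : Matrix (Fin (M + 1)) (Fin (M + 1)) ℝ) (i : Fin (M + 1)) :
    (A * B) i 0 = (A *ᵥ fun j => B j 0) i := by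
  simp [Matrix.mul_apply, Matrix.mulVec, dotProduct]

/-- **The peeling step** (stability of `π_k(GL)`: `GL_M → GL_{M+1}` is onto on `[Sᵏ, –]` for
`k < M`).  Every continuous `γ : Sᵏ → GL_{M+1}(ℝ)`, `k < M`, is homotopic through invertible
matrices to `u ↦ 1 ⊕ B(u)` for a continuous `B : Sᵏ → GL_M(ℝ)`.
[cite: Steenrod1951, §38] -/
theorem exists_homotopic_stab {k M : ℕ} (hkM : k < M) (γ : C(𝕊 k, NzMat (M + 1))) :
    ∃ B : C(𝕊 k, NzMat M), γ.Homotopic ⟨fun u => (B u).stab, continuous_stab.comp B.2⟩ := by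
  -- ### the first column and its normalisation
  set v : 𝕊 k → EuclideanSpace ℝ (Fin (M + 1)) := fun u => WithLp.toLp 2 fun i => (γ u).1 i 0
    with hv
  have hv0 : ∀ u, v u ≠ 0 := fun u h => col_zero_ne_zero (γ u) (by
    have := congrArg WithLp.ofLp h
    simpa [hv] using this)
  have hvc : Continuous v := by
    refine (PiLp.continuous_toLp 2 _).comp (continuous_pi fun i => ?_)
    exact ((continuous_apply (0 : Fin (M + 1))).comp ((continuous_apply i).comp
      (continuous_val.comp γ.continuous)))
  set a : 𝕊 k → EuclideanSpace ℝ (Fin (M + 1)) := fun u => ‖v u‖⁻¹ • v u with ha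
  have ha1 : ∀ u, ‖a u‖ = 1 := fun u => norm_smul_inv_norm (hv0 u)
  have hac : Continuous a := (hvc.norm.inv₀ fun u => norm_ne_zero_iff.2 (hv0 u)).smul hvc
  -- ### a nowhere antipodal unit field `b` missing the antipode `-p`
  have hd : finrank ℝ (EuclideanSpace ℝ (Fin k)) < M := by rw [finrank_euclideanSpace_fin]; exact hkM
  obtain ⟨b, p, hbc, hb1, hp1, hpb, hba⟩ :=
    exists_sphereMap_near_missing_antipode (𝓡 k) (S := 𝕊 k) hd hac ha1
  have hab : ∀ u, a u + b u ≠ 0 := fun u h => hba u ((add_comm (b u) (a u)).trans h)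
  have hbp : ∀ u, b u + p ≠ 0 := fun u h => hpb u ((add_comm p (b u)).trans h)
  -- ### an intermediate unit vector `q₀` between `p` and `e₀`
  set e0 : EuclideanSpace ℝ (Fin (M + 1)) := EuclideanSpace.single 0 1 with he0
  have he01 : ‖e0‖ = 1 := by simp [he0]
  obtain ⟨q₀, hq1, hpq, hqe⟩ : ∃ q₀ : EuclideanSpace ℝ (Fin (M + 1)), ‖q₀‖ = 1 ∧ p + q₀ ≠ 0 ∧
      q₀ + e0 ≠ 0 := by
    by_cases hpe : p + e0 = 0
    · -- `p = -e₀`: go through `e₁` (`M ≥ 1`)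
      obtain ⟨M', rfl⟩ : ∃ M', M = M' + 1 := ⟨M - 1, by omega⟩
      refine ⟨EuclideanSpace.single 1 1, by simp, fun h => ?_, fun h => ?_⟩
      · have hp : p = -e0 := eq_neg_of_add_eq_zero_left hpe
        have := congrArg (fun w : EuclideanSpace ℝ (Fin (M' + 1 + 1)) => w 1) h
        simp [hp, he0] at this
      · have := congrArg (fun w : EuclideanSpace ℝ (Fin (M' + 1 + 1)) => w 1) h
        simp [he0] at this
    · exact ⟨e0, he01, hpe, by
        rw [← two_smul ℝ e0]; exact smul_ne_zero two_ne_zero (by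
          rw [← norm_ne_zero_iff, he01]; exact one_ne_zero)⟩
  -- ### the rotations `a ↦ b ↦ p ↦ q₀ ↦ e₀`, all homotopic to `1`
  have hR₁det := fun u => det_rotMat_ne_zero (M := M + 1) (hb1 u) (hab u)
  have hR₂det := fun u => det_rotMat_ne_zero (M := M + 1) hp1 (hbp u)
  have hR₃det : ∀ _u : 𝕊 k, (rotMat (WithLp.ofLp p) (WithLp.ofLp q₀)).det ≠ 0 := fun _ =>
    det_rotMat_ne_zero hq1 hpq
  have hR₄det : ∀ _u : 𝕊 k, (rotMat (WithLp.ofLp q₀) (WithLp.ofLp e0)).det ≠ 0 := fun _ =>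
    det_rotMat_ne_zero he01 hqe
  have hR₁c := continuous_rotMat_mk hac hbc hb1 hab hR₁det
  have hR₂c := continuous_rotMat_mk hbc continuous_const (fun _ => hp1) hbp hR₂det
  have hR₃c := continuous_rotMat_mk (X := 𝕊 k) continuous_const continuous_const (fun _ => hq1)
    (fun _ => hpq) hR₃det
  have hR₄c := continuous_rotMat_mk (X := 𝕊 k) continuous_const continuous_const (fun _ => he01)
    (fun _ => hqe) hR₄det
  set R₁ : C(𝕊 k, NzMat (M + 1)) := ⟨_, hR₁c⟩ with hR₁
  set R₂ : C(𝕊 k, NzMat (M + 1)) := ⟨_, hR₂c⟩ with hR₂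
  set R₃ : C(𝕊 k, NzMat (M + 1)) := ⟨_, hR₃c⟩ with hR₃
  set R₄ : C(𝕊 k, NzMat (M + 1)) := ⟨_, hR₄c⟩ with hR₄
  have hh₁ := homotopic_one_rotMat hac hbc ha1 hb1 hab hR₁det hR₁c
  have hh₂ := homotopic_one_rotMat hbc continuous_const hb1 (fun _ => hp1) hbp hR₂det hR₂c
  have hh₃ := homotopic_one_rotMat (X := 𝕊 k) continuous_const continuous_const (fun _ => hp1)
    (fun _ => hq1) (fun _ => hpq) hR₃det hR₃c
  have hh₄ := homotopic_one_rotMat (X := 𝕊 k) continuous_const continuous_const (fun _ => hq1)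
    (fun _ => he01) (fun _ => hqe) hR₄det hR₄c
  -- the scalar `‖v‖⁻¹`
  have hsc : Continuous fun u => ‖v u‖⁻¹ := hvc.norm.inv₀ fun u => norm_ne_zero_iff.2 (hv0 u)
  have hspos : ∀ u, 0 < ‖v u‖⁻¹ := fun u => inv_pos.2 (norm_pos_iff.2 (hv0 u))
  have hSdet : ∀ u, (‖v u‖⁻¹ • (1 : Matrix (Fin (M + 1)) (Fin (M + 1)) ℝ)).det ≠ 0 := fun u =>
    det_smul_one_ne_zero (hspos u)
  have hScont : Continuous fun u => (⟨‖v u‖⁻¹ • (1 : Matrix (Fin (M + 1)) (Fin (M + 1)) ℝ),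
      hSdet u⟩ : NzMat (M + 1)) := (hsc.smul continuous_const).subtype_mk _
  set Sc : C(𝕊 k, NzMat (M + 1)) := ⟨_, hScont⟩ with hSc
  have hhS := homotopic_one_smul (M := M + 1) hsc hspos hSdet hScont
  -- ### the corrected map `γ₁ = S R₄ R₃ R₂ R₁ γ` has first column `e₀`
  set L : C(𝕊 k, NzMat (M + 1)) := Sc * R₄ * R₃ * R₂ * R₁ with hL
  have hL1 : (ContinuousMap.const (𝕊 k) (1 : NzMat (M + 1))).Homotopic L := by
    have h11 : (ContinuousMap.const (𝕊 k) (1 : NzMat (M + 1))) =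
        ContinuousMap.const (𝕊 k) 1 * ContinuousMap.const (𝕊 k) 1 * ContinuousMap.const (𝕊 k) 1 *
          ContinuousMap.const (𝕊 k) 1 * ContinuousMap.const (𝕊 k) 1 := by
      ext u : 1; simp
    rw [h11, hL]
    exact homotopic_mul (homotopic_mul (homotopic_mul (homotopic_mul hhS hh₄) hh₃) hh₂) hh₁
  set γ₁ : C(𝕊 k, NzMat (M + 1)) := L * γ with hγ₁
  have hγγ₁ : γ.Homotopic γ₁ := by
    have : γ = ContinuousMap.const (𝕊 k) (1 : NzMat (M + 1)) * γ := by ext u : 1; simp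
    rw [this, hγ₁]
    exact homotopic_mul hL1 (ContinuousMap.Homotopic.refl γ)
  have hcol : ∀ u, (fun i => (γ₁ u).1 i 0) = WithLp.ofLp e0 := by
    intro u
    have hve : WithLp.ofLp (v u) = fun i => (γ u).1 i 0 := rfl
    have hav : v u = ‖v u‖ • a u := by
      rw [ha, smul_smul, mul_inv_cancel₀ (norm_ne_zero_iff.2 (hv0 u)), one_smul]
    have step : ∀ (A : Matrix (Fin (M + 1)) (Fin (M + 1)) ℝ) (B : NzMat (M + 1)) (x y : Fin (M + 1) → ℝ),
        (fun i => B.1 i 0) = x → A *ᵥ x = y → (fun i => (A * B.1) i 0) = y := by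
      intro A B x y hx hy
      funext i
      rw [mul_apply_zero, show (fun j => B.1 j 0) = x from hx, hy]
    -- column of `γ`
    have c0 : (fun i => (γ u).1 i 0) = ‖v u‖ • WithLp.ofLp (a u) := by
      rw [← hve, ← WithLp.ofLp_smul, ← hav]
    have c1 : (fun i => ((R₁ * γ) u).1 i 0) = ‖v u‖ • WithLp.ofLp (b u) :=
      step _ _ _ _ c0 (by
        rw [mulVec_smul]; exact congrArg _ (rotMat_mulVec_unit (ha1 u) (hb1 u) (hab u)))
    have c2 : (fun i => ((R₂ * (R₁ * γ)) u).1 i 0) = ‖v u‖ • WithLp.ofLp p :=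
      step _ _ _ _ c1 (by
        rw [mulVec_smul]; exact congrArg _ (rotMat_mulVec_unit (hb1 u) hp1 (hbp u)))
    have c3 : (fun i => ((R₃ * (R₂ * (R₁ * γ))) u).1 i 0) = ‖v u‖ • WithLp.ofLp q₀ :=
      step _ _ _ _ c2 (by
        rw [mulVec_smul]; exact congrArg _ (rotMat_mulVec_unit hp1 hq1 hpq))
    have c4 : (fun i => ((R₄ * (R₃ * (R₂ * (R₁ * γ)))) u).1 i 0) = ‖v u‖ • WithLp.ofLp e0 :=
      step _ _ _ _ c3 (by
        rw [mulVec_smul]; exact congrArg _ (rotMat_mulVec_unit hq1 he01 hqe))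
    have c5 : (fun i => ((Sc * (R₄ * (R₃ * (R₂ * (R₁ * γ))))) u).1 i 0) = WithLp.ofLp e0 :=
      step _ _ _ _ c4 (by
        show (‖v u‖⁻¹ • (1 : Matrix (Fin (M + 1)) (Fin (M + 1)) ℝ)) *ᵥ (‖v u‖ • WithLp.ofLp e0) = _
        rw [smul_mulVec, one_mulVec, smul_smul,
          inv_mul_cancel₀ (norm_ne_zero_iff.2 (hv0 u)), one_smul])
    have hassoc : γ₁ = Sc * (R₄ * (R₃ * (R₂ * (R₁ * γ)))) := by
      rw [hγ₁, hL]; simp only [mul_assoc]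
    rw [hassoc]
    exact c5
  have h00 : ∀ u, (γ₁ u).1 0 0 = 1 := fun u => by
    have := congrFun (hcol u) 0
    simpa [he0] using this
  have hi0 : ∀ u (i : Fin M), (γ₁ u).1 i.succ 0 = 0 := fun u i => by
    have := congrFun (hcol u) i.succ
    simpa [he0, Fin.succ_ne_zero] using this
  -- ### the lower-right block and the shear homotopy
  have hBdet : ∀ u, ((γ₁ u).1.submatrix Fin.succ Fin.succ).det ≠ 0 := fun u => by
    rw [← det_shearBlock 1 (fun j => (γ₁ u).1 0 j.succ), ← eq_shearBlock_of_apply_zero (h00 u) (hi0 u)]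
    exact (γ₁ u).2
  have hγ₁c : Continuous fun u => (γ₁ u).1 := continuous_val.comp γ₁.continuous
  have hBc : Continuous fun u => (γ₁ u).1.submatrix Fin.succ Fin.succ :=
    continuous_matrix fun i j =>
      show Continuous fun u => (γ₁ u).1 i.succ j.succ from
        (continuous_apply _).comp ((continuous_apply _).comp hγ₁c)
  set B : C(𝕊 k, NzMat M) := ⟨fun u => ⟨(γ₁ u).1.submatrix Fin.succ Fin.succ, hBdet u⟩,
    hBc.subtype_mk _⟩ with hB
  refine ⟨B, hγγ₁.trans ?_⟩
  have hrc : Continuous fun u => fun j : Fin M => (γ₁ u).1 0 j.succ :=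
    continuous_pi fun j => show Continuous fun u => (γ₁ u).1 0 j.succ from
      (continuous_apply _).comp ((continuous_apply _).comp hγ₁c)
  refine homotopic_of_family
    (fun q => shearBlock (1 - (q.1 : ℝ)) (fun j => (γ₁ q.2).1 0 j.succ)
      ((γ₁ q.2).1.submatrix Fin.succ Fin.succ)) ?_ ?_ _ _ (fun u => ?_) (fun u => ?_)
  · exact continuous_shearBlock (continuous_const.sub (continuous_subtype_val.comp continuous_fst))
      (hrc.comp continuous_snd) (hBc.comp continuous_snd)
  · intro q
    rw [det_shearBlock]
    exact hBdet q.2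
  · show shearBlock (1 - ((0 : unitInterval) : ℝ)) _ _ = _
    rw [Set.Icc.coe_zero, sub_zero]
    exact (eq_shearBlock_of_apply_zero (h00 u) (hi0 u)).symm
  · show shearBlock (1 - ((1 : unitInterval) : ℝ)) _ _ = _
    rw [Set.Icc.coe_one, sub_self, shearBlock_zero]
    rfl

/-! ### Iteration: `Sᵏ → GL_{m+j}` deforms into `1_j ⊕ GL_m` for `k < m` -/

/-- The `j`-fold block stabilisation `A ↦ 1_j ⊕ A`, `GL_m → GL_{m+j}`. [folklore] -/
def stabPow {m : ℕ} : (j : ℕ) → NzMat m → NzMat (m + j)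
  | 0 => id
  | j + 1 => fun A => (stabPow j A).stab

/-- `stabPow 0 = id`. [folklore] -/
@[simp] theorem stabPow_zero {m : ℕ} (A : NzMat m) : stabPow 0 A = A := rfl

/-- `stabPow (j + 1) = stab ∘ stabPow j`. [folklore] -/
theorem stabPow_succ {m : ℕ} (j : ℕ) (A : NzMat m) : stabPow (j + 1) A = (stabPow j A).stab := rfl

/-- `stabPow j` is continuous. [folklore] -/
theorem continuous_stabPow {m : ℕ} : ∀ j : ℕ, Continuous (stabPow (m := m) j)
  | 0 => continuous_id
  | j + 1 => continuous_stab.comp (continuous_stabPow j)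

/-- Post-composition of a continuous map with `stabPow j`. [folklore] -/
def stabPowMap {m : ℕ} (j : ℕ) (α : C(X, NzMat m)) : C(X, NzMat (m + j)) :=
  ⟨fun x => stabPow j (α x), (continuous_stabPow j).comp α.2⟩

/-- Values of `stabPowMap`. [folklore] -/
@[simp] theorem stabPowMap_apply {m : ℕ} (j : ℕ) (α : C(X, NzMat m)) (x : X) :
    stabPowMap j α x = stabPow j (α x) := rfl

/-- **Stable-range surjectivity of `[Sᵏ, GL_m] → [Sᵏ, GL_{m+j}]` for `k < m`**: every continuous
`γ : Sᵏ → GL_{m+j}(ℝ)` is homotopic through invertible matrices to `u ↦ 1_j ⊕ α(u)` for some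
continuous `α : Sᵏ → GL_m(ℝ)` (peel `j` times; the `i`-th step needs `k < m + j - i`).
[cite: Steenrod1951, §38] [cite: HatcherAT2002, §4.2, Example 4.55] -/
theorem exists_homotopic_stabPow {k m : ℕ} (hk : k < m) :
    ∀ (j : ℕ) (γ : C(𝕊 k, NzMat (m + j))), ∃ α : C(𝕊 k, NzMat m), γ.Homotopic (stabPowMap j α)
  | 0, γ => ⟨γ, by
      have : stabPowMap 0 γ = γ := by ext u : 1; rfl
      rw [this]⟩
  | j + 1, γ => by
      obtain ⟨B, hB⟩ := exists_homotopic_stab (M := m + j) (by omega) γ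
      obtain ⟨α, hα⟩ := exists_homotopic_stabPow hk j B
      refine ⟨α, hB.trans ?_⟩
      have h1 : (⟨fun u => (B u).stab, continuous_stab.comp B.2⟩ : C(𝕊 k, NzMat (m + j + 1))) =
          (⟨NzMat.stab, continuous_stab⟩ : C(NzMat (m + j), NzMat (m + j + 1))).comp B := rfl
      have h2 : stabPowMap (j + 1) α =
          (⟨NzMat.stab, continuous_stab⟩ : C(NzMat (m + j), NzMat (m + j + 1))).comp
            (stabPowMap j α) := rfl
      rw [h1, h2]
      exact (ContinuousMap.Homotopic.refl _).comp hα

/-! ### Smoothing a continuous map into `GL_m` -/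

/-- **A continuous map `Sᵏ → GL_m(ℝ)` is homotopic to one with `C^∞` entries** (smooth
approximation inside the open set `{det ≠ 0}`; close maps are joined by the segment, which stays
invertible). [folklore] -/
theorem exists_contMDiff_homotopic {k m : ℕ} (α : C(𝕊 k, NzMat m)) :
    ∃ (β : 𝕊 k → Matrix (Fin m) (Fin m) ℝ) (hβ : ∀ u, (β u).det ≠ 0),
      (∀ i j, ContMDiff (𝓡 k) 𝓘(ℝ) ∞ fun u => β u i j) ∧
      ∃ hc : Continuous fun u => (⟨β u, hβ u⟩ : NzMat m), α.Homotopic ⟨_, hc⟩ := by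
  -- the entries as a map into the normed space `Fin m → Fin m → ℝ`
  set f : 𝕊 k → (Fin m → Fin m → ℝ) := fun u => (α u).1 with hf
  have hfc : Continuous f := continuous_val.comp α.continuous
  -- `{det ≠ 0}` is open and contains the compact image: a uniform margin
  have hUo : IsOpen {A : Fin m → Fin m → ℝ | Matrix.det (A : Matrix (Fin m) (Fin m) ℝ) ≠ 0} :=
    isOpen_ne_fun (Continuous.matrix_det continuous_id) continuous_const
  have hKU : range f ⊆ {A : Fin m → Fin m → ℝ | Matrix.det (A : Matrix (Fin m) (Fin m) ℝ) ≠ 0} := by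
    rintro _ ⟨u, rfl⟩; exact (α u).2
  obtain ⟨ε, hε, hthick⟩ := (isCompact_range hfc).exists_thickening_subset_open hUo hKU
  obtain ⟨g, hg, -⟩ := hfc.exists_contMDiff_approx (𝓡 k) ⊤ continuous_const fun _ => hε
  have hseg : ∀ (u : 𝕊 k) (t : ℝ), 0 ≤ t → t ≤ 1 →
      Matrix.det (((1 - t) • f u + t • g u : Fin m → Fin m → ℝ) : Matrix (Fin m) (Fin m) ℝ) ≠ 0 := by
    intro u t ht0 ht1
    apply hthick
    refine mem_thickening_iff.2 ⟨f u, ⟨u, rfl⟩, ?_⟩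
    calc dist ((1 - t) • f u + t • g u) (f u) = ‖t • (g u - f u)‖ := by
          rw [dist_eq_norm]; congr 1; module
      _ ≤ ‖g u - f u‖ := by
          rw [norm_smul, Real.norm_eq_abs, abs_of_nonneg ht0]
          exact mul_le_of_le_one_left (norm_nonneg _) ht1
      _ < ε := by rw [← dist_eq_norm]; exact hg u
  have hgdet : ∀ u, Matrix.det ((g u : Fin m → Fin m → ℝ) : Matrix (Fin m) (Fin m) ℝ) ≠ 0 := by
    intro u
    have := hseg u 1 zero_le_one le_rfl
    simpa using this
  refine ⟨fun u => g u, hgdet, fun i j => ?_, ?_⟩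
  · have h1 : ContMDiff (𝓡 k) 𝓘(ℝ, Fin m → ℝ) ∞ fun u => g u i :=
      (ContinuousLinearMap.proj (R := ℝ) (φ := fun _ : Fin m => Fin m → ℝ) i).contMDiff.comp g.contMDiff
    exact (ContinuousLinearMap.proj (R := ℝ) (φ := fun _ : Fin m => ℝ) j).contMDiff.comp h1
  · have hgc : Continuous fun u => (⟨g u, hgdet u⟩ : NzMat m) :=
      (show Continuous fun u => (g u : Matrix (Fin m) (Fin m) ℝ) from g.contMDiff.continuous).subtype_mk _
    refine ⟨hgc, homotopic_of_family (fun q => ((1 - (q.1 : ℝ)) • f q.2 + (q.1 : ℝ) • g q.2 :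
      Fin m → Fin m → ℝ)) ?_ (fun q => hseg q.2 q.1 q.1.2.1 q.1.2.2) _ _ (fun u => by simp [hf])
      (fun u => by simp)⟩
    exact ((continuous_const.sub (continuous_subtype_val.comp continuous_fst)).smul
      (hfc.comp continuous_snd)).add ((continuous_subtype_val.comp continuous_fst).smul
        (g.contMDiff.continuous.comp continuous_snd))

end StableFrames.NzMat

end Literature.Topology.FourManifolds
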